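import Literature.NumberTheory.LFunctions.AriasDeReynaLineNumerics
import Literature.NumberTheory.LFunctions.AriasDeReynaLeadingCoefficient
import Literature.NumberTheory.LFunctions.AriasDeReynaCoefficientBound
import Mathlib.Analysis.SpecialFunctions.Pow.Continuity
import HarnessLib

/-!
# Lehmer's form of the Riemann–Siegel expansion with Arias de Reyna's bounds, for every `a > 0`

Topic `Literature/NumberTheory/LFunctions` (namespace `Literature.NumberTheory.LFunctions.AriasDeReyna`).

Assembly of Arias de Reyna 2011, Thm. 3.1 (`rsLineIntegral_sub_main_eq`), Thm. 4.1 (`norm_coefC_le`),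
Thm. 4.2 (`norm_rsLineIntegral_sub_expansion_le`, non-integer `a`) and `|C₀| ≤ ½` (`norm_coefC0_le_of_pos`)
into the statement consumed by Polymath 15, Prop. 6.2, for EVERY `t > 0`: at an integer saddle point
`a = √(t/2π) = N` both sides of the bound are continuous in `a ∈ [N, N+1)` (dominated convergence for the
coefficient integrals), so the bound passes to the limit `a ↓ N`.

## References

* J. Arias de Reyna, *High precision computation of Riemann's zeta function by the Riemann–Siegel formula, I*,
  Math. Comp. 80 (2011), 995–1009: Thm. 3.1, Thm. 4.1, Thm. 4.2, eq. (5.2), Thm. 6.1. [AriasDeReyna2011]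
* D. H. J. Polymath, *Effective approximation of heat flow evolution of the Riemann ξ function, and a new upper
  bound for the de Bruijn–Newman constant*, Res. Math. Sci. 6 (2019), Prop. 6.2. [Polymath2019]
-/

noncomputable section

open Complex MeasureTheory Set Filter Real
open scoped Topology
open Literature.NumberTheory.LFunctions.SiegelIntegral Literature.NumberTheory.LFunctions.Gabcke

namespace Literature.NumberTheory.LFunctions

namespace AriasDeReyna

/-! ## Continuity of the coefficient integrals in `a` -/

/-- `sin π(a + u(1+i)) ≠ 0` for `u ≠ 0` (its imaginary part is `πu`). [folklore] -/
private lemma sin_line_ne_zero (a : ℝ) {u : ℝ} (hu : u ≠ 0) : Complex.sin (π * line a u) ≠ 0 := by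
  intro h
  obtain ⟨k, hk⟩ := Complex.sin_eq_zero_iff.1 h
  have := congrArg Complex.im hk
  simp only [line, Complex.mul_im, Complex.intCast_re, Complex.intCast_im, Complex.ofReal_re, Complex.ofReal_im,
    Complex.add_re, Complex.add_im, Complex.mul_re, Complex.one_re, Complex.one_im, Complex.I_re, Complex.I_im,
    zero_mul, mul_zero, add_zero, sub_zero, zero_add, mul_one] at this
  have : π * u = 0 := by linarith
  rcases mul_eq_zero.1 this with h | h
  · exact Real.pi_ne_zero h
  · exact hu h

/-- **Continuity of `a ↦ ∫ e^{−4πu²} q_k(σ,4πu²)(−u(1+i))^k du/(2i sin π(a+u(1+i)))`** (`k ≥ 1`), by dominated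
convergence with the `a`-independent majorant of `norm_coefIntegrand_le`. [cite: AriasDeReyna2011, eq. (3.9)] -/
theorem continuous_integral_coefIntegrand (σ : ℝ) {k : ℕ} (hk : 1 ≤ k) :
    Continuous fun a : ℝ ↦ ∫ u : ℝ, coefIntegrand σ a k u := by
  set M : ℝ := circleConst σ (1 / 2) * Real.sqrt 2 ^ k / (2 * π * (1 / 2) ^ k) with hM
  refine continuous_of_dominated
    (bound := fun u ↦ M * ((1 + |u|) ^ (k - 1) * Real.exp (-2 * π * u ^ 2 + 0 * u + 0)))
    (fun a ↦ (measurable_coefIntegrand σ a k).aestronglyMeasurable) (fun a ↦ Eventually.of_forall fun u ↦ ?_)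
    ((integrable_poly_mul_gaussian (k - 1) 0 0).const_mul M) (Eventually.of_forall fun u ↦ ?_)
  · refine (norm_coefIntegrand_le σ a hk (by norm_num : (0:ℝ) < 1 / 2) (by norm_num) u).trans ?_
    rw [← hM]
    have hM0 : 0 ≤ M := div_nonneg (mul_nonneg (circleConst_pos (by norm_num) (by norm_num)).le (by positivity))
      (by positivity)
    refine mul_le_mul_of_nonneg_left ?_ hM0
    have hm := half_le_one_add_re_fKer_neg_half
    refine mul_le_mul (pow_le_pow_left₀ (abs_nonneg u) (by linarith [abs_nonneg u]) _) ?_ (Real.exp_pos _).le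
      (by positivity)
    rw [Real.exp_le_exp]
    have h0 : 0 ≤ π * u ^ 2 * (2 * (1 + (fKer (-(1 / 2 : ℝ))).re) - 1) :=
      mul_nonneg (mul_nonneg Real.pi_pos.le (sq_nonneg u)) (by linarith)
    nlinarith [h0]
  · by_cases hu : u = 0
    · subst hu
      have : ∀ a : ℝ, coefIntegrand σ a k 0 = 0 := fun a ↦ by
        simp [coefIntegrand, zero_pow (Nat.one_le_iff_ne_zero.1 hk)]
      simp only [this]
      exact continuous_const
    · unfold coefIntegrand
      refine Continuous.div continuous_const ?_ fun a ↦ ?_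
      · simp only [line_eq]; fun_prop
      · exact mul_ne_zero (mul_ne_zero two_ne_zero I_ne_zero) (sin_line_ne_zero a hu)

/-! ## The bound at integer saddle points -/

/-- **Thm. 4.2 (with Thms. 3.1 and the coefficients of eq. (3.11)) at an integer saddle point `a = N ≥ 1`**, by
continuity from the right: on `[N, N+1)` the coefficients are `a`-continuous integrals and
`s ↦ ∫_{N+½↙}` is entire. [cite: AriasDeReyna2011, Thm. 4.2, eqs. (4.7)–(4.8) (case `a ∈ ℤ`, Thm. 3.1 with the half circle)] -/
theorem norm_rsLineIntegral_sub_expansion_le_nat {N : ℕ} (hN : 1 ≤ N) (σ : ℝ) {K : ℕ} (hK1 : 1 ≤ K)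
    (hσK : 0 ≤ σ ∨ (2 : ℝ) ≤ K + σ) :
    ‖rsLineIntegral (⌊((N : ℝ))⌋₊ + 1 / 2) ((σ : ℂ) + (2 * π * (N : ℝ) ^ 2 : ℝ) * I) -
        (-1) ^ (⌊((N : ℝ))⌋₊ + 1) * uPhase N * ((N : ℝ) : ℂ) ^ (-(σ : ℂ)) *
          ∑ k ∈ Finset.range (K + 1), coef σ N k / ((N : ℝ) : ℂ) ^ k‖ ≤
      (N : ℝ) ^ (-σ) * (if 0 ≤ σ then 1 / 7 * (2 : ℝ) ^ (3 * σ / 2) else 1 / 2 * (9 / 10 : ℝ) ^ ⌈-σ⌉₊) *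
        Real.Gamma (((K : ℝ) + 1) / 2) / ((N : ℝ) / 1.1) ^ (K + 1) := by
  have hN0 : (0 : ℝ) < N := by exact_mod_cast hN
  -- `a`-continuous versions of the coefficients on `[N, N+1)`
  set L : ℝ → ℂ := fun a : ℝ ↦ (1 + I) * ∫ u : ℝ,
    cexp (2 * π * I * (line (N + 1 / 2) u - a) ^ 2) / (2 * I * Complex.sin (π * line (N + 1 / 2) u)) with hL
  set cN : ℝ → ℕ → ℂ := fun a k ↦ if k = 0 then (-1) ^ (N + 1) * cexp (-(π * I / 8)) * (-L a)
    else (-1) ^ (N + 1) * cConst * ∫ u : ℝ, coefIntegrand σ a k u with hcN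
  have hcoef : ∀ a ∈ Ico (N : ℝ) (N + 1), ∀ k, coef σ a k = cN a k := by
    intro a ha k
    have hfl := Nat.floor_eq_on_Ico N a ha
    simp only [hcN, coef, coefC0, coefC, leadM, hfl, hL]
  have hsum : ∀ a ∈ Ico (N : ℝ) (N + 1), ∑ k ∈ Finset.range (K + 1), coef σ a k / (a : ℂ) ^ k =
      ∑ k ∈ Finset.range (K + 1), cN a k / (a : ℂ) ^ k := fun a ha ↦
    Finset.sum_congr rfl fun k _ ↦ by rw [hcoef a ha k]
  set G : ℝ → ℝ := fun a ↦ ‖rsLineIntegral (N + 1 / 2) ((σ : ℂ) + (2 * π * a ^ 2 : ℝ) * I) -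
      (-1) ^ (N + 1) * uPhase a * (a : ℂ) ^ (-(σ : ℂ)) * ∑ k ∈ Finset.range (K + 1), cN a k / (a : ℂ) ^ k‖ with hG
  set B : ℝ → ℝ := fun a ↦ a ^ (-σ) * (if 0 ≤ σ then 1 / 7 * (2 : ℝ) ^ (3 * σ / 2) else 1 / 2 * (9 / 10 : ℝ) ^ ⌈-σ⌉₊) *
      Real.Gamma (((K : ℝ) + 1) / 2) / (a / 1.1) ^ (K + 1) with hB
  -- (1) `G ≤ B` on `(N, N+1)`
  have hGB : ∀ᶠ a in 𝓝[>] (N : ℝ), G a ≤ B a := by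
    filter_upwards [Ioo_mem_nhdsGT (by linarith : (N : ℝ) < N + 1)] with a ha
    have ha0 : 0 < a := hN0.trans ha.1
    have hai : ∀ n : ℤ, (n : ℝ) ≠ a := fun n hn ↦ by
      rw [← hn] at ha
      have h1 : (N : ℤ) < n := by exact_mod_cast ha.1
      have h2 : n < (N : ℤ) + 1 := by exact_mod_cast ha.2
      omega
    have hfl := Nat.floor_eq_on_Ico N a ⟨ha.1.le, ha.2⟩
    have h := norm_rsLineIntegral_sub_expansion_le ha0 hai σ hK1 hσK
    rw [hfl, hsum a ⟨ha.1.le, ha.2⟩] at h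
    exact h
  -- (2) continuity of `G` and `B` at `N`
  have hGc : ContinuousAt G N := by
    refine ContinuousAt.norm (ContinuousAt.sub ?_ ?_)
    · have hc : (0 : ℝ) < N + 1 / 2 := by linarith
      have hcn : ∀ n : ℤ, (n : ℝ) ≠ N + 1 / 2 := fun n hn ↦ by
        have h2 : (2 * n : ℤ) = (2 * N + 1 : ℤ) := by
          have : (2 * n : ℝ) = 2 * N + 1 := by rw [hn]; ring
          exact_mod_cast this
        omega
      exact ((differentiable_rsLineIntegral hc hcn).continuous.comp
        (by fun_prop : Continuous fun a : ℝ ↦ (σ : ℂ) + ((2 * π * a ^ 2 : ℝ) : ℂ) * I)).continuousAt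
    · refine ContinuousAt.mul (ContinuousAt.mul (continuousAt_const.mul ?_) ?_) ?_
      · have h1 : ContinuousAt (fun a : ℝ ↦ (2 * π * a ^ 2 * Real.log a - π * a ^ 2 - π / 8 : ℝ)) N :=
          ((((continuousAt_const.mul (continuousAt_id.pow 2)).mul (Real.continuousAt_log hN0.ne')).sub
            (continuousAt_const.mul (continuousAt_id.pow 2))).sub continuousAt_const)
        have h2 : ContinuousAt (fun a : ℝ ↦ -I * (((2 * π * a ^ 2 * Real.log a - π * a ^ 2 - π / 8 : ℝ)) : ℂ)) N :=
          continuousAt_const.mul (Complex.continuous_ofReal.continuousAt.comp h1)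
        exact h2.cexp
      · exact Complex.continuousAt_ofReal_cpow_const _ _ (Or.inr hN0.ne')
      · have hterm : ∀ k : ℕ, ContinuousAt (fun a : ℝ ↦ cN a k / (a : ℂ) ^ k) N := fun k ↦ by
          refine ContinuousAt.div ?_ ((Complex.continuous_ofReal.pow k).continuousAt)
            (pow_ne_zero _ (by exact_mod_cast hN0.ne'))
          rcases Nat.eq_zero_or_pos k with hk | hk
          · subst hk
            simp only [hcN, if_true]
            exact continuousAt_const.mul ((continuous_leadIntegral N).continuousAt.neg)
          · simp only [hcN, Nat.pos_iff_ne_zero.1 hk, if_false]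
            exact continuousAt_const.mul (continuous_integral_coefIntegrand σ hk).continuousAt
        exact tendsto_finsetSum _ fun k _ ↦ hterm k
  have hBc : ContinuousAt B N := by
    refine ((ContinuousAt.mul (ContinuousAt.mul ?_ continuousAt_const) continuousAt_const).div
      (((continuous_id.div_const _).pow _).continuousAt) (pow_ne_zero _ (by positivity)))
    exact Real.continuousAt_rpow_const _ _ (Or.inl hN0.ne')
  -- (3) pass to the limit `a ↓ N`
  have hlim := le_of_tendsto_of_tendsto (hGc.tendsto.mono_left nhdsWithin_le_nhds)
    (hBc.tendsto.mono_left nhdsWithin_le_nhds) hGB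
  have hflN : ⌊(N : ℝ)⌋₊ = N := Nat.floor_natCast N
  rw [hflN, hsum N ⟨le_rfl, by linarith⟩]
  exact hlim

/-- **Arias de Reyna's bound of Thm. 4.2 for the expansion of Thm. 3.1, for EVERY `a > 0`** (`a ∉ ℤ`:
`norm_rsLineIntegral_sub_expansion_le`; `a ∈ ℤ`: the limit above).
[cite: AriasDeReyna2011, Thm. 3.1 (eq. (3.11)) and Thm. 4.2 (eqs. (4.7)–(4.8))] -/
theorem norm_rsLineIntegral_sub_expansion_le_of_pos {a : ℝ} (ha : 0 < a) (σ : ℝ) {K : ℕ} (hK1 : 1 ≤ K)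
    (hσK : 0 ≤ σ ∨ (2 : ℝ) ≤ K + σ) :
    ‖rsLineIntegral (⌊a⌋₊ + 1 / 2) ((σ : ℂ) + (2 * π * a ^ 2 : ℝ) * I) -
        (-1) ^ (⌊a⌋₊ + 1) * uPhase a * (a : ℂ) ^ (-(σ : ℂ)) * ∑ k ∈ Finset.range (K + 1), coef σ a k / (a : ℂ) ^ k‖ ≤
      a ^ (-σ) * (if 0 ≤ σ then 1 / 7 * (2 : ℝ) ^ (3 * σ / 2) else 1 / 2 * (9 / 10 : ℝ) ^ ⌈-σ⌉₊) *
        Real.Gamma (((K : ℝ) + 1) / 2) / (a / 1.1) ^ (K + 1) := by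
  by_cases hai : ∃ n : ℤ, (n : ℝ) = a
  · obtain ⟨n, rfl⟩ := hai
    have hn : (0 : ℤ) < n := by exact_mod_cast ha
    obtain ⟨N, rfl⟩ := Int.eq_ofNat_of_zero_le hn.le
    rw [Int.cast_natCast]
    exact norm_rsLineIntegral_sub_expansion_le_nat (by exact_mod_cast hn) σ hK1 hσK
  · exact norm_rsLineIntegral_sub_expansion_le ha (fun n hn ↦ hai ⟨n, hn⟩) σ hK1 hσK

/-! ## The statement consumed by Polymath 15 -/

/-- **Arias de Reyna 2011, Thm. 3.1 with the bounds of Thms. 4.1, 4.2 and `|C₀| ≤ ½`**, in the existential form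
of Polymath 15, Prop. 6.2: for `σ` real, `t > 0`, `a = √(t/2π)`, `N = ⌊a⌋`, `K ≥ 1` with `σ ≥ 0` or `K + σ ≥ 2`,
the coefficients `C_k = coef σ a k` satisfy `|C₀| ≤ ½`, `|C_k| ≤ c(σ)Γ(k/2)/b(σ)^k` (`1 ≤ k ≤ K`) and
`|∫_{N↙N+1} − (−1)^{N+1} U a^{−σ} Σ_{k ≤ K} C_k a^{−k}| ≤ a^{−σ} c₁(σ) Γ((K+1)/2)/(a/1.1)^{K+1}`.
[cite: AriasDeReyna2011, Thm. 3.1 (eq. (3.11)), Thm. 4.1 (eqs. (4.1)–(4.3)), Thm. 4.2 (eqs. (4.7)–(4.8)), eq. (5.2), Thm. 6.1]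
[cite: Polymath2019, Prop. 6.2] -/
theorem lehmer_expansion_bound (σ t : ℝ) (K : ℕ) (ht : 0 < t) (hK : 1 ≤ K) (hσK : 0 ≤ σ ∨ (2 : ℝ) ≤ K + σ) :
    ∃ C : ℕ → ℂ, ‖C 0‖ ≤ 1 / 2 ∧
      (∀ k : ℕ, 1 ≤ k → k ≤ K →
        ‖C k‖ ≤ (if 0 < σ then (9 : ℝ) ^ σ / (Real.sqrt 2 * π) else (2 : ℝ) ^ (-σ) / (Real.sqrt 2 * π)) *
          Real.Gamma ((k : ℝ) / 2) / (if 0 < σ then 2 else Real.sqrt ((3 - 2 * Real.log 2) * π)) ^ k) ∧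
      ‖rsLineIntegral (⌊Real.sqrt (t / (2 * π))⌋₊ + 1 / 2) ((σ : ℂ) + t * I) -
          (-1 : ℂ) ^ (⌊Real.sqrt (t / (2 * π))⌋₊ + 1) *
            cexp (-I * ((t / 2 * Real.log (t / (2 * π)) - t / 2 - π / 8 : ℝ) : ℂ)) *
            ((Real.sqrt (t / (2 * π)) : ℂ) ^ (-(σ : ℂ))) *
              ∑ k ∈ Finset.range (K + 1), C k / ((Real.sqrt (t / (2 * π)) : ℂ)) ^ k‖ ≤
        Real.sqrt (t / (2 * π)) ^ (-σ) * (if 0 ≤ σ then 1 / 7 * (2 : ℝ) ^ (3 * σ / 2) else 1 / 2 * (9 / 10 : ℝ) ^ ⌈-σ⌉₊) *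
          Real.Gamma (((K : ℝ) + 1) / 2) / (Real.sqrt (t / (2 * π)) / 1.1) ^ (K + 1) := by
  set a := Real.sqrt (t / (2 * π)) with ha
  have ht2 : 0 ≤ t / (2 * π) := by positivity
  have ha0 : 0 < a := Real.sqrt_pos.2 (by positivity)
  have ha2 : a ^ 2 = t / (2 * π) := by rw [ha, Real.sq_sqrt ht2]
  have hta : 2 * π * a ^ 2 = t := by rw [ha2]; field_simp
  refine ⟨coef σ a, ?_, fun k hk _ ↦ ?_, ?_⟩
  · simp only [coef, if_true]
    exact norm_coefC0_le_of_pos ha0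
  · simp only [coef, Nat.pos_iff_ne_zero.1 hk, if_false]
    exact norm_coefC_le σ a hk
  · have h := norm_rsLineIntegral_sub_expansion_le_of_pos ha0 σ hK hσK
    have hU : uPhase a = cexp (-I * ((t / 2 * Real.log (t / (2 * π)) - t / 2 - π / 8 : ℝ) : ℂ)) := by
      rw [uPhase, show (2 * π * a ^ 2 * Real.log a - π * a ^ 2 - π / 8 : ℝ)
        = t / 2 * Real.log (t / (2 * π)) - t / 2 - π / 8 by
          rw [ha, Real.log_sqrt ht2, ← ha, ← hta]; ring]
    rw [hta, hU] at h
    exact h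

end AriasDeReyna

end Literature.NumberTheory.LFunctions
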